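import Literature.MathematicalPhysics.QuantumLattice.SectorGroundState
import Literature.MathematicalPhysics.QuantumLattice.ApproximateEigenvectorLemmas
import Literature.MathematicalPhysics.QuantumLattice.RayleighBottom
import Literature.MathematicalPhysics.QuantumLattice.FreeFermiGasPairGramBounds
import HarnessLib

/-!
# A-posteriori enclosures of a ground state from one trial vector: Kato–Temple, the eigenvector
# (mixing) bound, and certified intervals for ground-state expectations

Topic `MathematicalPhysics/QuantumLattice` (family `hubbard`); companion of
`HubbardSectorEnclosureCertificate.lean` (two-sided ENERGY enclosures) and `SectorGroundState.lean`
(the tracial sector ground state `projState (sectorGroundProj A K)`). This file is the soundness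
theorem behind certified intervals for ground-state CORRELATORS (double occupancy, spin structure
factor, spin correlations) obtained from exact diagonalisation with exact-rational post-processing:
a trial vector `w` (say an integer-rounded Lanczos vector) with Rayleigh quotient `ρ = Re ⟨w, A w⟩`
and residual `r² = ‖A w‖² - ρ²`, together with a certificate that the SECOND eigenvalue of `A` on the
sector `K` is `≥ σ > ρ`, enclose the sector ground energy, force the sector ground state to be
simple, bound its angle to `w`, and hence enclose every ground-state expectation `⟨O⟩₀` in an
interval around `⟨O⟩_w`. Everything is finite-dimensional linear algebra on `ι → ℂ` with Mathlib's
`dotProduct`/`mulVec` (`⟨v, w⟩ = star v ⬝ᵥ w`), for a Hermitian matrix `A` and an `A`-invariant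
subspace `K` (a particle-number / `S^z` / symmetry sector; `K = ⊤` allowed). PROVED, no named facts,
no definitions.

* `TempleKato.gap_of_codimOne_certificate` — **the gap certificate**: if `Re ⟨z, A z⟩ ≥ σ ‖z‖²` on a
  subspace `W` and `K ≤ W + ℂ u` (codimension ≤ 1 in `K`), and `K` contains a unit eigenvector `ψ`,
  `A ψ = e ψ`, with `e < σ`, then `Re ⟨z, A z⟩ ≥ σ ‖z‖²` for every `z ∈ K` orthogonal to `ψ`
  ("`λ₂(A|_K) ≥ σ`"; the two-dimensional step of Courant–Fischer, Horn–Johnson Thm 4.2.6).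
  Certificate shapes supplying `(W, u)`: `exists_codimOne_of_vector_certificate` (form bound on
  `K ∩ v^⊥`), `form_ge_of_ldl_certificate` (**`LDLᴴ` inertia**: `A - σ = L D Lᴴ` with all but one
  pivot `≥ 0`; Golub–Van Loan §8.1.5 Thm 8.1.17 / §8.4.2), `form_ge_of_rankOne_certificate`
  (**rank-one-shifted PSD**: `A - σ + c u uᴴ ⪰ 0`), and the FRAME versions
  `frame_form_ge_of_ldl_certificate`, `frame_form_ge_of_rankOne_certificate`,
  `exists_codimOne_of_frame_certificate` for a sector presented as the column span of a matrix `Φ`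
  (orbit / symmetry-adapted bases; Gram matrix `Φᴴ Φ`, compressed matrix `Φᴴ A Φ`).
* `TempleKato.temple_core`, `TempleKato.kato_temple_lower` — **Kato–Temple**: with the gap above `ψ`,
  `‖A x‖² - (e + σ) Re ⟨x, A x⟩ + e σ ‖x‖² ≥ 0` on `K`, hence for a unit trial vector `w ∈ K` with
  `ρ < σ`: `e ≥ ρ - r²/(σ - ρ)`. [cite: Saad1992, Ch. III §3.2 Lemma 3.1, Thm 3.8; Kato1949; Temple1928]
* `TempleKato.sin_sq_mul_gap_le` — **the eigenvector bound**: `(1 - |⟨ψ, w⟩|²)(σ - e) ≤ ρ - e`, hence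
  with Kato–Temple `(1 - |⟨ψ, w⟩|²)(σ - ρ)² ≤ r²` (`sin ∠(w, ψ) ≤ r/(σ - ρ)`, in the packaged
  theorems). [cite: Saad1992, Ch. III §3.2 Thm 3.9; DavisKahan1970]
* `TempleKato.eq_smul_of_eigen` — the sector ground state is SIMPLE (`K ∩ ker (A - e) = ℂ ψ`), so the
  tracial sector ground state is the vector state: `TempleKato.projState_sectorGroundProj_eq`.
* `TempleKato.abs_expect_sub_expect_le` — **mixing bound for expectations**: for unit `ψ`, `w` with
  `1 - |⟨w, ψ⟩|² ≤ β²`, `0 ≤ β`, and a Hermitian `O` with `|⟨x, (O - m) x⟩| ≤ h ‖x‖²`: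
  `|Re ⟨ψ, O ψ⟩ - Re ⟨w, O w⟩| ≤ 2 h (β + β²)`; sharper variant with the observable residual
  `s_O ≥ ‖(O - ⟨O⟩_w) w‖`: `TempleKato.abs_expect_sub_expect_le_of_residual`
  (`≤ 2 β s_O + β² (h + |⟨O⟩_w - m|)`). [folklore]
* PACKAGED: `TempleKato.sector_enclosure` (sector `K`: energy two-sided, simplicity, the gap on
  `K ∩ ψ^⊥`, eigenvector bound), `TempleKato.sector_expectation_enclosure` (the correlator interval
  for `Re ((A.sectorGroundProj K).projState O)`), the unnormalised-trial-vector form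
  `TempleKato.sector_enclosure_of_sums` (inputs = the exact numbers `⟨w,w⟩, ⟨w,Aw⟩, ⟨Aw,Aw⟩` of an
  integer vector), the whole-space form `TempleKato.groundState_enclosure` (`A.groundEnergy`,
  `A.HasUniqueGroundState`, `A.groundStateFunctional`), and `TempleKato.diagonal_form_bound` (the
  form hypothesis for a diagonal observable with entries in `[m - h, m + h]`).

How a certificate row is discharged (dictionary for the cell `pub-mbboot`, ADV-2 implementations
S/H/X/H-hub/C): `A` = the sector block (or the Hamiltonian with `K` = the sector), `w` = the stored
integer vector, `ρ = ⟨w,Aw⟩/⟨w,w⟩`, `r² = ⟨Aw,Aw⟩/⟨w,w⟩ - ρ²` (exact rationals), `σ` = the certified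
`λ₂` lower bound from an `LDLᴴ` inertia count (`form_ge_of_ldl_certificate`, frame version for an
orbit basis) or a rank-one-shifted Cholesky/PSD test (`form_ge_of_rankOne_certificate`), `β` any
rational `≥ r/(σ - ρ)`; the printed interval `⟨O⟩_w ± 2‖O - m‖(β + β²)` is then
`sector_expectation_enclosure` / `groundState_enclosure`.

## References
* Y. Saad, *Numerical Methods for Large Eigenvalue Problems*, Manchester Univ. Press (1992), Ch. III
  §3.2 "A posteriori error bounds": Lemma 3.1, Thm 3.8 (Kato–Temple), Cor. 3.4, Thm 3.9 (read in the
  open 1992 edition, PDF pp. 134–136). [Saad1992] (revised ed. SIAM 2011 [Saad2011])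
* T. Kato, J. Phys. Soc. Japan 4 (1949) 334–339 [Kato1949]; G. Temple, Proc. R. Soc. A 119 (1928) 276
  [Temple1928]; M. Reed, B. Simon, *Methods of Modern Mathematical Physics IV*, Thm XIII.5 [ReedSimonIV1978].
* C. Davis, W. M. Kahan, SIAM J. Numer. Anal. 7 (1970) 1–46 (`sin Θ` theorem) [DavisKahan1970].
* G. H. Golub, C. F. Van Loan, *Matrix Computations*, 4th ed. (2013), §8.1.5 Thm 8.1.17 (Sylvester's
  law of inertia), §8.4.2 (eigenvalue counts from `LDLᵀ`; PDF pp. 417, 435) [GolubVanLoan2013];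
  R. A. Horn, C. R. Johnson, *Matrix Analysis*, 2nd ed., Thm 4.2.6, §4.3 (Courant–Fischer, interlacing
  under rank-one perturbations) [HornJohnson2013].
* H. Tasaki, *Physics and Mathematics of Quantum Many-Body Systems* (2020), §2.1–2.2, App. A.2
  (ground states in a sector; the tree's `minEnergyOn`, `sectorGroundProj`, `projState`). [Tasaki2020]
-/

noncomputable section

open Matrix Finset
open scoped ComplexOrder BigOperators ComplexConjugate

namespace Literature.MathematicalPhysics.QuantumLattice

namespace TempleKato

open EigenvalueContinuation

variable {ι : Type*} [Fintype ι] [DecidableEq ι]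

/-! ### Bookkeeping on `⟨v, w⟩ = star v ⬝ᵥ w` -/

omit [DecidableEq ι] in
/-- `⟨v, v⟩` is the real number `Re ⟨v, v⟩`. [folklore] -/
theorem star_dotProduct_self_eq_re (v : ι → ℂ) : star v ⬝ᵥ v = ((star v ⬝ᵥ v).re : ℂ) :=
  Complex.ext (by simp) (by simp [im_star_dotProduct_self])

omit [DecidableEq ι] in
/-- For Hermitian `A`, `⟨x, A x⟩` is real. [folklore] -/
theorem star_dotProduct_mulVec_self_eq_re {A : Matrix ι ι ℂ} (hA : Aᴴ = A) (x : ι → ℂ) :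
    star x ⬝ᵥ A *ᵥ x = ((star x ⬝ᵥ A *ᵥ x).re : ℂ) := by
  have h : star (star x ⬝ᵥ A *ᵥ x) = star x ⬝ᵥ A *ᵥ x := (star_dotProduct_mulVec_comm hA x x).symm
  have him : (star x ⬝ᵥ A *ᵥ x).im = 0 := by
    have := congrArg Complex.im h
    rw [Complex.star_def, Complex.conj_im] at this
    linarith
  exact Complex.ext (by simp) (by simp [him])

omit [DecidableEq ι] in
/-- `|⟨x, x⟩| = Re ⟨x, x⟩`. [folklore] -/
theorem norm_star_dotProduct_self (x : ι → ℂ) : ‖star x ⬝ᵥ x‖ = (star x ⬝ᵥ x).re := by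
  conv_lhs => rw [star_dotProduct_self_eq_re x]
  rw [Complex.norm_real, Real.norm_of_nonneg (re_star_dotProduct_self_nonneg x)]

/-! ### Splitting a vector along a unit vector -/

omit [DecidableEq ι] in
/-- The component of `x` orthogonal to a unit vector `ψ`: with `α = ⟨ψ, x⟩` and `z = x - α ψ`,
`⟨ψ, z⟩ = 0` and `x = α ψ + 1 • z`. [folklore] -/
theorem orth_split {ψ : ι → ℂ} (hψ1 : star ψ ⬝ᵥ ψ = 1) (x : ι → ℂ) :
    star ψ ⬝ᵥ (x - (star ψ ⬝ᵥ x) • ψ) = 0 ∧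
      x = (star ψ ⬝ᵥ x) • ψ + (1 : ℂ) • (x - (star ψ ⬝ᵥ x) • ψ) := by
  refine ⟨?_, by rw [one_smul]; abel⟩
  rw [dotProduct_sub, dotProduct_smul, hψ1, smul_eq_mul, mul_one, sub_self]

omit [DecidableEq ι] in
/-- **Norm and energy of `α ψ + b z`** for an eigenvector `ψ` (`A ψ = e ψ`, `A` Hermitian) and
`z ⊥ ψ`: `‖α ψ + b z‖² = |α|² ‖ψ‖² + |b|² ‖z‖²` and
`Re ⟨α ψ + b z, A (α ψ + b z)⟩ = e |α|² ‖ψ‖² + |b|² Re ⟨z, A z⟩` (the cross terms vanish because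
`⟨ψ, A z⟩ = conj ⟨z, A ψ⟩ = e conj ⟨z, ψ⟩ = 0`). [folklore] -/
theorem norm_energy_pair {A : Matrix ι ι ℂ} (hA : Aᴴ = A) {e : ℝ} {ψ z : ι → ℂ}
    (hAψ : A *ᵥ ψ = (e : ℂ) • ψ) (horth : star ψ ⬝ᵥ z = 0) (α b : ℂ) :
    (star (α • ψ + b • z) ⬝ᵥ (α • ψ + b • z)).re =
        ‖α‖ ^ 2 * (star ψ ⬝ᵥ ψ).re + ‖b‖ ^ 2 * (star z ⬝ᵥ z).re ∧
      (star (α • ψ + b • z) ⬝ᵥ A *ᵥ (α • ψ + b • z)).re =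
        e * (‖α‖ ^ 2 * (star ψ ⬝ᵥ ψ).re) + ‖b‖ ^ 2 * (star z ⬝ᵥ A *ᵥ z).re := by
  have hss : ∀ a : ℂ, star a * a = ((‖a‖ ^ 2 : ℝ) : ℂ) := fun a => by
    rw [Complex.star_def, ← Complex.normSq_eq_conj_mul_self, Complex.normSq_eq_norm_sq]
  have horth' : star z ⬝ᵥ ψ = 0 := by rw [star_dotProduct, horth, star_zero]
  have hψAz : star ψ ⬝ᵥ A *ᵥ z = 0 := by
    rw [star_dotProduct_mulVec_comm hA, hAψ, dotProduct_smul, horth', smul_zero, star_zero]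
  have hzAψ : star z ⬝ᵥ A *ᵥ ψ = 0 := by rw [hAψ, dotProduct_smul, horth', smul_zero]
  have h1 : star (α • ψ + b • z) ⬝ᵥ (α • ψ + b • z) =
      ((‖α‖ ^ 2 : ℝ) : ℂ) * (star ψ ⬝ᵥ ψ) + ((‖b‖ ^ 2 : ℝ) : ℂ) * (star z ⬝ᵥ z) := by
    rw [RayleighBottom.star_lincomb_dotProduct, horth, horth', mul_zero, mul_zero, add_zero, add_zero,
      hss, hss]
  have h2 : star (α • ψ + b • z) ⬝ᵥ A *ᵥ (α • ψ + b • z) =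
      ((‖α‖ ^ 2 : ℝ) : ℂ) * ((e : ℂ) * (star ψ ⬝ᵥ ψ)) + ((‖b‖ ^ 2 : ℝ) : ℂ) * (star z ⬝ᵥ A *ᵥ z) := by
    rw [RayleighBottom.star_lincomb_dotProduct_mulVec, hψAz, hzAψ, mul_zero, mul_zero, add_zero,
      add_zero, hss, hss, hAψ, dotProduct_smul, smul_eq_mul]
  constructor
  · rw [h1, Complex.add_re, Complex.re_ofReal_mul, Complex.re_ofReal_mul]
  · rw [h2, Complex.add_re, Complex.re_ofReal_mul, Complex.re_ofReal_mul, Complex.re_ofReal_mul]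
    ring

/-! ### The gap certificate: a form bound on a subspace of codimension ≤ 1 -/

omit [DecidableEq ι] in
/-- **Gap certificate.** Let `A` be Hermitian, `ψ ∈ K` a unit eigenvector `A ψ = e ψ`, and suppose
`Re ⟨z, A z⟩ ≥ σ ‖z‖²` on a subspace `W` with `K ≤ W + ℂ u` (every `x ∈ K` is `z + c u`, `z ∈ W`).
If `e < σ`, then `Re ⟨z, A z⟩ ≥ σ ‖z‖²` for every `z ∈ K` orthogonal to `ψ` — i.e. the second
eigenvalue of `A|_K` is `≥ σ` (the plane spanned by `ψ` and `z` meets `W`; on that plane the form is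
`e |α|² + Re⟨z,Az⟩ |b|²`). Two-dimensional step of Courant–Fischer, Horn–Johnson (2013) Thm 4.2.6.
[folklore] -/
theorem gap_of_codimOne_certificate {A : Matrix ι ι ℂ} (hA : Aᴴ = A)
    {K W : Submodule ℂ (ι → ℂ)} {u : ι → ℂ} {σ e : ℝ}
    (hW : ∀ z ∈ W, σ * (star z ⬝ᵥ z).re ≤ (star z ⬝ᵥ A *ᵥ z).re)
    (hWK : ∀ x ∈ K, ∃ z ∈ W, ∃ c : ℂ, x = z + c • u)
    {ψ : ι → ℂ} (hψK : ψ ∈ K) (hψ1 : star ψ ⬝ᵥ ψ = 1) (hAψ : A *ᵥ ψ = (e : ℂ) • ψ) (he : e < σ)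
    {z : ι → ℂ} (hzK : z ∈ K) (hz : star ψ ⬝ᵥ z = 0) :
    σ * (star z ⬝ᵥ z).re ≤ (star z ⬝ᵥ A *ᵥ z).re := by
  obtain ⟨z₁, hz₁W, c₁, hψeq⟩ := hWK ψ hψK
  obtain ⟨z₂, hz₂W, c₂, hzeq⟩ := hWK z hzK
  by_cases hc₁ : c₁ = 0
  · -- then `ψ ∈ W`, so `σ ≤ e`: contradiction
    have hψW : ψ ∈ W := by rw [hψeq, hc₁, zero_smul, add_zero]; exact hz₁W
    have h := hW ψ hψW
    rw [re_star_dotProduct_mulVec_of_eigen hAψ, hψ1, Complex.one_re, mul_one, mul_one] at h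
    exact absurd h (not_le.2 he)
  · -- `x = -c₂ ψ + c₁ z = c₁ z₂ - c₂ z₁ ∈ W`
    have hxW : (-c₂) • ψ + c₁ • z ∈ W := by
      have : (-c₂) • ψ + c₁ • z = c₁ • z₂ - c₂ • z₁ := by
        rw [hzeq, hψeq]
        module
      rw [this]
      exact W.sub_mem (W.smul_mem _ hz₂W) (W.smul_mem _ hz₁W)
    have hb := hW _ hxW
    obtain ⟨hn, hE⟩ := norm_energy_pair hA hAψ hz (-c₂) c₁
    rw [hn, hE] at hb
    simp only [hψ1, Complex.one_re, mul_one, norm_neg] at hb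
    have hc₁pos : 0 < ‖c₁‖ ^ 2 := by positivity
    have key : ‖c₁‖ ^ 2 * (σ * (star z ⬝ᵥ z).re) ≤ ‖c₁‖ ^ 2 * (star z ⬝ᵥ A *ᵥ z).re := by
      nlinarith [sq_nonneg ‖c₂‖]
    exact le_of_mul_le_mul_left key hc₁pos

/-! ### Kato–Temple and the eigenvector bound, given the gap above `ψ` -/

section Gap

variable {A : Matrix ι ι ℂ} {K : Submodule ℂ (ι → ℂ)} {σ e : ℝ} {ψ : ι → ℂ}

omit [DecidableEq ι] in
/-- **Temple's quadratic inequality.** If `A` is Hermitian, `ψ ∈ K` is a unit eigenvector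
`A ψ = e ψ` with `e < σ`, and `Re ⟨z, A z⟩ ≥ σ ‖z‖²` on `K ∩ ψ^⊥`, then for every `x ∈ K`:
`‖A x‖² - (e + σ) Re ⟨x, A x⟩ + e σ ‖x‖² ≥ 0` (`= Re ⟨(A - e) x, (A - σ) x⟩`; with `x = α ψ + z`
it is `‖A z‖² - (e+σ) Re⟨z,Az⟩ + eσ‖z‖²`, and `n` times this is `≥ (p - e n)(p - σ n) ≥ 0`,
`p = Re⟨z,Az⟩ ≥ σ n`, `n = ‖z‖²`, by Cauchy–Schwarz). Saad (1992) Ch. III Lemma 3.1.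
[cite: Saad1992, Ch. III §3.2 Lemma 3.1] -/
theorem temple_core (hA : Aᴴ = A) (hψK : ψ ∈ K) (hψ1 : star ψ ⬝ᵥ ψ = 1)
    (hAψ : A *ᵥ ψ = (e : ℂ) • ψ) (he : e < σ)
    (hgap : ∀ z ∈ K, star ψ ⬝ᵥ z = 0 → σ * (star z ⬝ᵥ z).re ≤ (star z ⬝ᵥ A *ᵥ z).re)
    {x : ι → ℂ} (hxK : x ∈ K) :
    0 ≤ (star (A *ᵥ x) ⬝ᵥ A *ᵥ x).re - (e + σ) * (star x ⬝ᵥ A *ᵥ x).re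
      + e * σ * (star x ⬝ᵥ x).re := by
  obtain ⟨hz, hsplit⟩ := orth_split hψ1 x
  set α : ℂ := star ψ ⬝ᵥ x with hα
  set z : ι → ℂ := x - α • ψ with hzdef
  have hzK : z ∈ K := K.sub_mem hxK (K.smul_mem _ hψK)
  -- the three quantities of `x` in terms of `α` and `z`
  obtain ⟨hn, hE⟩ := norm_energy_pair hA hAψ hz α 1
  rw [← hsplit] at hn hE
  simp only [hψ1, Complex.one_re, mul_one, norm_one, one_pow, one_mul] at hn hE
  -- `‖A x‖² = |α e|² + ‖A z‖²`
  have hψAz : star ψ ⬝ᵥ A *ᵥ z = 0 := by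
    have horth' : star z ⬝ᵥ ψ = 0 := by rw [star_dotProduct, hz, star_zero]
    rw [star_dotProduct_mulVec_comm hA, hAψ, dotProduct_smul, horth', smul_zero, star_zero]
  have hAzψ : star (A *ᵥ z) ⬝ᵥ ψ = 0 := by rw [star_dotProduct, hψAz, star_zero]
  have hAx : A *ᵥ x = (α * e) • ψ + (1 : ℂ) • (A *ᵥ z) := by
    conv_lhs => rw [hsplit]
    rw [mulVec_add, mulVec_smul, mulVec_smul, hAψ, smul_smul, one_smul]
  have hss : ∀ a : ℂ, star a * a = ((‖a‖ ^ 2 : ℝ) : ℂ) := fun a => by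
    rw [Complex.star_def, ← Complex.normSq_eq_conj_mul_self, Complex.normSq_eq_norm_sq]
  have hq : (star (A *ᵥ x) ⬝ᵥ A *ᵥ x).re =
      ‖α‖ ^ 2 * e ^ 2 + (star (A *ᵥ z) ⬝ᵥ A *ᵥ z).re := by
    rw [hAx, RayleighBottom.star_lincomb_dotProduct, hψAz, hAzψ, mul_zero, mul_zero, add_zero,
      add_zero, hss, hss, hψ1, mul_one, Complex.add_re,
      Complex.ofReal_re, Complex.re_ofReal_mul, norm_mul, Complex.norm_real, Real.norm_eq_abs,
      mul_pow, sq_abs, norm_one, one_pow, one_mul]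
  rw [hq, hE, hn]
  -- now the inequality for `z`
  set p := (star z ⬝ᵥ A *ᵥ z).re with hp
  set q := (star (A *ᵥ z) ⬝ᵥ A *ᵥ z).re with hqdef
  set n := (star z ⬝ᵥ z).re with hndef
  have hpn : σ * n ≤ p := hgap z hzK hz
  have hn0 : 0 ≤ n := re_star_dotProduct_self_nonneg z
  have hq0 : 0 ≤ q := re_star_dotProduct_self_nonneg _
  have hCS : p ^ 2 ≤ n * q := by
    have h := norm_star_dotProduct_sq_le z (A *ᵥ z)
    have hre : |p| ≤ ‖star z ⬝ᵥ A *ᵥ z‖ := Complex.abs_re_le_norm _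
    have : p ^ 2 ≤ ‖star z ⬝ᵥ A *ᵥ z‖ ^ 2 := by
      rw [← sq_abs p]; exact pow_le_pow_left₀ (abs_nonneg _) hre 2
    exact this.trans h
  have key : 0 ≤ q - (e + σ) * p + e * σ * n := by
    rcases hn0.lt_or_eq with hnpos | hnz
    · -- `n (q - (e+σ) p + e σ n) ≥ p² - (e+σ) p n + e σ n² = (p - e n)(p - σ n) ≥ 0`
      have h1 : 0 ≤ (p - e * n) * (p - σ * n) := by
        apply mul_nonneg <;> nlinarith
      nlinarith
    · -- `n = 0`: then `p = 0` by Cauchy–Schwarz, and `q ≥ 0`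
      have hp0 : p = 0 := by
        have : p ^ 2 ≤ 0 := by rw [← hnz, zero_mul] at hCS; exact hCS
        nlinarith [sq_nonneg p]
      rw [hp0, ← hnz]; simpa using hq0
  nlinarith [key, sq_nonneg ‖α‖]

omit [DecidableEq ι] in
/-- **Kato–Temple lower bound.** Under the hypotheses of `temple_core`, a unit trial vector `w ∈ K`
with Rayleigh quotient `ρ = Re ⟨w, A w⟩ < σ` gives `e ≥ ρ - (‖A w‖² - ρ²)/(σ - ρ)`.
Saad (1992) Ch. III Thm 3.8 (with `b = σ`, `λ = e` the eigenvalue left of `ρ`); Kato (1949);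
Temple (1928); Reed–Simon IV Thm XIII.5. [cite: Saad1992, Ch. III §3.2 Thm 3.8] -/
theorem kato_temple_lower (hA : Aᴴ = A) (hψK : ψ ∈ K) (hψ1 : star ψ ⬝ᵥ ψ = 1)
    (hAψ : A *ᵥ ψ = (e : ℂ) • ψ) (he : e < σ)
    (hgap : ∀ z ∈ K, star ψ ⬝ᵥ z = 0 → σ * (star z ⬝ᵥ z).re ≤ (star z ⬝ᵥ A *ᵥ z).re)
    {w : ι → ℂ} (hwK : w ∈ K) (hw1 : star w ⬝ᵥ w = 1) (hρ : (star w ⬝ᵥ A *ᵥ w).re < σ) :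
    (star w ⬝ᵥ A *ᵥ w).re
        - ((star (A *ᵥ w) ⬝ᵥ A *ᵥ w).re - (star w ⬝ᵥ A *ᵥ w).re ^ 2)
          / (σ - (star w ⬝ᵥ A *ᵥ w).re) ≤ e := by
  have h := temple_core hA hψK hψ1 hAψ he hgap hwK
  rw [hw1, Complex.one_re, mul_one] at h
  set ρ := (star w ⬝ᵥ A *ᵥ w).re
  set a := (star (A *ᵥ w) ⬝ᵥ A *ᵥ w).re
  have hσρ : 0 < σ - ρ := sub_pos.2 hρ
  have h2 : ρ - e ≤ (a - ρ ^ 2) / (σ - ρ) := by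
    rw [le_div_iff₀ hσρ]
    nlinarith
  linarith

omit [DecidableEq ι] in
/-- **The eigenvector bound** `(1 - |⟨ψ, w⟩|²)(σ - e) ≤ ρ - e` for a unit `w ∈ K`
(`ρ = e cos² + Re⟨z,Az⟩`, `Re⟨z,Az⟩ ≥ σ sin²`). Saad (1992) Ch. III, proof of Thm 3.9.
[cite: Saad1992, Ch. III §3.2 Thm 3.9] -/
theorem sin_sq_mul_gap_le (hA : Aᴴ = A) (hψ1 : star ψ ⬝ᵥ ψ = 1)
    (hAψ : A *ᵥ ψ = (e : ℂ) • ψ) (hψK : ψ ∈ K)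
    (hgap : ∀ z ∈ K, star ψ ⬝ᵥ z = 0 → σ * (star z ⬝ᵥ z).re ≤ (star z ⬝ᵥ A *ᵥ z).re)
    {w : ι → ℂ} (hwK : w ∈ K) (hw1 : star w ⬝ᵥ w = 1) :
    (1 - ‖star ψ ⬝ᵥ w‖ ^ 2) * (σ - e) ≤ (star w ⬝ᵥ A *ᵥ w).re - e := by
  obtain ⟨hz, hsplit⟩ := orth_split hψ1 w
  set α : ℂ := star ψ ⬝ᵥ w
  set z : ι → ℂ := w - α • ψ
  have hzK : z ∈ K := K.sub_mem hwK (K.smul_mem _ hψK)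
  obtain ⟨hn, hE⟩ := norm_energy_pair hA hAψ hz α 1
  rw [← hsplit] at hn hE
  simp only [hψ1, Complex.one_re, mul_one, norm_one, one_pow, one_mul] at hn hE
  rw [hw1, Complex.one_re] at hn
  have hpn := hgap z hzK hz
  rw [hE]
  have hα : ‖α‖ ^ 2 = 1 - (star z ⬝ᵥ z).re := by linarith
  rw [hα]
  nlinarith

omit [DecidableEq ι] in
/-- **Simplicity.** Under the gap hypothesis with `e < σ`, every eigenvector `φ ∈ K` of `A` with the
eigenvalue `e` is a multiple of `ψ`: `φ = ⟨ψ, φ⟩ ψ` (its component orthogonal to `ψ` is an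
`e`-eigenvector in `K ∩ ψ^⊥`, where the form is `≥ σ > e`). [folklore] -/
theorem eq_smul_of_eigen (hψ1 : star ψ ⬝ᵥ ψ = 1) (hAψ : A *ᵥ ψ = (e : ℂ) • ψ) (hψK : ψ ∈ K)
    (he : e < σ)
    (hgap : ∀ z ∈ K, star ψ ⬝ᵥ z = 0 → σ * (star z ⬝ᵥ z).re ≤ (star z ⬝ᵥ A *ᵥ z).re)
    {φ : ι → ℂ} (hφK : φ ∈ K) (hAφ : A *ᵥ φ = (e : ℂ) • φ) :
    φ = (star ψ ⬝ᵥ φ) • ψ := by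
  obtain ⟨hz, -⟩ := orth_split hψ1 φ
  set α : ℂ := star ψ ⬝ᵥ φ
  set z : ι → ℂ := φ - α • ψ with hzdef
  have hzK : z ∈ K := K.sub_mem hφK (K.smul_mem _ hψK)
  have hAz : A *ᵥ z = (e : ℂ) • z := by
    rw [hzdef, mulVec_sub, mulVec_smul, hAφ, hAψ, smul_sub, smul_comm]
  have h := hgap z hzK hz
  rw [re_star_dotProduct_mulVec_of_eigen hAz] at h
  have hn0 : (star z ⬝ᵥ z).re ≤ 0 := by
    rcases (re_star_dotProduct_self_nonneg z).lt_or_eq with hpos | h0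
    · exact absurd (le_of_mul_le_mul_right h hpos) (not_le.2 he)
    · exact h0.symm.le
  have hz0 : z = 0 := by
    by_contra hne
    exact absurd hn0 (not_le.2 (re_star_dotProduct_self_pos hne))
  exact sub_eq_zero.1 hz0

end Gap

/-! ### The mixing bound for expectations -/

omit [DecidableEq ι] in
/-- Expansion of the form and of the norm at `a + s z` (`s` real, `a ⊥ z`). [folklore] -/
theorem form_norm_expand (B : Matrix ι ι ℂ) {a z : ι → ℂ} (horth : star a ⬝ᵥ z = 0) (s : ℝ) :
    star (a + (s : ℂ) • z) ⬝ᵥ B *ᵥ (a + (s : ℂ) • z) =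
        star a ⬝ᵥ B *ᵥ a + (s : ℂ) * (star a ⬝ᵥ B *ᵥ z + star z ⬝ᵥ B *ᵥ a)
          + (s : ℂ) ^ 2 * (star z ⬝ᵥ B *ᵥ z) ∧
      (star (a + (s : ℂ) • z) ⬝ᵥ (a + (s : ℂ) • z)).re =
        (star a ⬝ᵥ a).re + s ^ 2 * (star z ⬝ᵥ z).re := by
  have horth' : star z ⬝ᵥ a = 0 := by rw [star_dotProduct, horth, star_zero]
  constructor
  · have h := RayleighBottom.star_lincomb_dotProduct_mulVec B 1 (s : ℂ) a z
    rw [one_smul] at h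
    rw [h, star_one, one_mul, one_mul, mul_one, Complex.star_def, Complex.conj_ofReal]
    ring
  · have h := RayleighBottom.star_lincomb_dotProduct 1 (s : ℂ) a z
    rw [one_smul] at h
    rw [h, horth, horth', mul_zero, mul_zero, add_zero, add_zero, star_one, one_mul,
      Complex.star_def, Complex.conj_ofReal, Complex.add_re, ← Complex.ofReal_mul,
      Complex.re_ofReal_mul]
    ring

omit [DecidableEq ι] in
/-- Polarisation bound for a `B` with `|⟨x, B x⟩| ≤ h ‖x‖²`: for `a ⊥ z` (`⟨a, z⟩ = 0`) and real
`t > 0`, the cross term `X = ⟨a, B z⟩ + ⟨z, B a⟩` satisfies `|X| ≤ h (‖a‖²/t + t ‖z‖²)`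
(`2 t X` is the difference of the forms at `a ± t z`). [folklore] -/
theorem cross_term_bound {B : Matrix ι ι ℂ} {h : ℝ}
    (hB : ∀ x : ι → ℂ, ‖star x ⬝ᵥ B *ᵥ x‖ ≤ h * (star x ⬝ᵥ x).re)
    {a z : ι → ℂ} (horth : star a ⬝ᵥ z = 0) {t : ℝ} (ht : 0 < t) :
    ‖star a ⬝ᵥ B *ᵥ z + star z ⬝ᵥ B *ᵥ a‖ ≤ h * ((star a ⬝ᵥ a).re / t + t * (star z ⬝ᵥ z).re) := by
  set X := star a ⬝ᵥ B *ᵥ z + star z ⬝ᵥ B *ᵥ a with hX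
  set F := star a ⬝ᵥ B *ᵥ a with hF
  set G := star z ⬝ᵥ B *ᵥ z with hG
  set Na := (star a ⬝ᵥ a).re with hNa
  set Nz := (star z ⬝ᵥ z).re with hNz
  obtain ⟨ep, np⟩ := form_norm_expand B horth t
  obtain ⟨em, nm⟩ := form_norm_expand B horth (-t)
  have hplus := hB (a + (t : ℂ) • z)
  have hminus := hB (a + ((-t : ℝ) : ℂ) • z)
  rw [ep, np] at hplus
  rw [em, nm] at hminus
  have hdiff : (((2 * t : ℝ)) : ℂ) * X =
      (F + (t : ℂ) * X + (t : ℂ) ^ 2 * G) - (F + ((-t : ℝ) : ℂ) * X + ((-t : ℝ) : ℂ) ^ 2 * G) := by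
    push_cast; ring
  have h3 : 2 * t * ‖X‖ ≤ 2 * (h * (Na + t ^ 2 * Nz)) := by
    have hnorm : 2 * t * ‖X‖ = ‖(((2 * t : ℝ)) : ℂ) * X‖ := by
      rw [norm_mul, Complex.norm_real, Real.norm_of_nonneg (by positivity)]
    rw [hnorm, hdiff]
    refine (norm_sub_le _ _).trans ?_
    have : (-t) ^ 2 = t ^ 2 := by ring
    rw [this] at hminus
    linarith
  have ht' : h * (Na / t + t * Nz) = (h * (Na + t ^ 2 * Nz)) / t := by
    field_simp
  rw [ht', le_div_iff₀ ht]
  linarith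

omit [DecidableEq ι] in
/-- The orthogonal split of a unit vector `ψ` along a unit vector `w`: `ψ = α w + z`, `z ⊥ w`,
`‖z‖² = 1 - |α|²`. [folklore] -/
theorem unit_split {ψ w : ι → ℂ} (hψ1 : star ψ ⬝ᵥ ψ = 1) (hw1 : star w ⬝ᵥ w = 1) :
    star w ⬝ᵥ (ψ - (star w ⬝ᵥ ψ) • w) = 0 ∧
      ψ = (star w ⬝ᵥ ψ) • w + (1 : ℂ) • (ψ - (star w ⬝ᵥ ψ) • w) ∧
      (star (ψ - (star w ⬝ᵥ ψ) • w) ⬝ᵥ (ψ - (star w ⬝ᵥ ψ) • w)).re = 1 - ‖star w ⬝ᵥ ψ‖ ^ 2 := by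
  obtain ⟨hz, hsplit⟩ := orth_split hw1 ψ
  refine ⟨hz, hsplit, ?_⟩
  have hss : ∀ a : ℂ, star a * a = ((‖a‖ ^ 2 : ℝ) : ℂ) := fun a => by
    rw [Complex.star_def, ← Complex.normSq_eq_conj_mul_self, Complex.normSq_eq_norm_sq]
  have horth' : star (ψ - (star w ⬝ᵥ ψ) • w) ⬝ᵥ w = 0 := by rw [star_dotProduct, hz, star_zero]
  have h := RayleighBottom.star_lincomb_dotProduct (star w ⬝ᵥ ψ) 1 w (ψ - (star w ⬝ᵥ ψ) • w)
  rw [← hsplit, hψ1, hw1, hz, horth', mul_zero, mul_zero, add_zero, add_zero, mul_one, star_one,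
    one_mul, one_mul, hss] at h
  have := congrArg Complex.re h
  rw [Complex.one_re, Complex.add_re, Complex.ofReal_re] at this
  linarith

/-- **Mixing bound for expectations.** Let `O` be Hermitian with `|⟨x, (O - m) x⟩| ≤ h ‖x‖²` for all
`x` (e.g. a diagonal observable with entries in `[m - h, m + h]`), and let `ψ`, `w` be unit vectors
with `1 - |⟨w, ψ⟩|² ≤ β²`, `0 ≤ β` (`sin ∠(w, ψ) ≤ β`). Then
`|Re ⟨ψ, O ψ⟩ - Re ⟨w, O w⟩| ≤ 2 h (β + β²)`. (Write `ψ = α w + z`, `z ⊥ w`, `‖z‖² ≤ β²`; the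
diagonal terms contribute `≤ h β²` each and the cross term `≤ 2 h β` by `cross_term_bound` with
`t = 1/β`.) [folklore] -/
theorem abs_expect_sub_expect_le {O : Matrix ι ι ℂ} {m h β : ℝ}
    (hOform : ∀ x : ι → ℂ, ‖star x ⬝ᵥ O *ᵥ x - (m : ℂ) * (star x ⬝ᵥ x)‖ ≤ h * (star x ⬝ᵥ x).re)
    {ψ w : ι → ℂ} (hψ1 : star ψ ⬝ᵥ ψ = 1) (hw1 : star w ⬝ᵥ w = 1) (hβ : 0 ≤ β)
    (hover : 1 - ‖star w ⬝ᵥ ψ‖ ^ 2 ≤ β ^ 2) :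
    |(star ψ ⬝ᵥ O *ᵥ ψ).re - (star w ⬝ᵥ O *ᵥ w).re| ≤ 2 * h * (β + β ^ 2) := by
  have hss : ∀ a : ℂ, star a * a = ((‖a‖ ^ 2 : ℝ) : ℂ) := fun a => by
    rw [Complex.star_def, ← Complex.normSq_eq_conj_mul_self, Complex.normSq_eq_norm_sq]
  -- pass to `B = O - m`
  set B : Matrix ι ι ℂ := O - (m : ℂ) • (1 : Matrix ι ι ℂ) with hBdef
  have hBO : ∀ x : ι → ℂ, star x ⬝ᵥ B *ᵥ x = star x ⬝ᵥ O *ᵥ x - (m : ℂ) * (star x ⬝ᵥ x) := by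
    intro x
    rw [hBdef, sub_mulVec, smul_mulVec, one_mulVec, dotProduct_sub, dotProduct_smul, smul_eq_mul]
  have hBform : ∀ x : ι → ℂ, ‖star x ⬝ᵥ B *ᵥ x‖ ≤ h * (star x ⬝ᵥ x).re := fun x => by
    rw [hBO]; exact hOform x
  have hh : 0 ≤ h := by
    have := hBform ψ
    rw [hψ1, Complex.one_re, mul_one] at this
    exact (norm_nonneg _).trans this
  have hred : (star ψ ⬝ᵥ O *ᵥ ψ).re - (star w ⬝ᵥ O *ᵥ w).re =
      (star ψ ⬝ᵥ B *ᵥ ψ - star w ⬝ᵥ B *ᵥ w).re := by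
    rw [hBO, hBO, hψ1, hw1, Complex.sub_re, Complex.sub_re, Complex.sub_re]
    ring
  rw [hred]
  -- split `ψ = α w + z`
  obtain ⟨hz, hsplit, hnz⟩ := unit_split hψ1 hw1
  set α : ℂ := star w ⬝ᵥ ψ with hα
  set z : ι → ℂ := ψ - α • w with hzdef
  have hzβ : (star z ⬝ᵥ z).re ≤ β ^ 2 := by rw [hnz]; exact hover
  have hα1 : ‖α‖ ^ 2 ≤ 1 := by
    have := re_star_dotProduct_self_nonneg z
    rw [hnz] at this; linarith
  -- expansion of `⟨ψ, B ψ⟩`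
  have horthα : star (α • w) ⬝ᵥ z = 0 := by rw [star_smul, smul_dotProduct, hz, smul_zero]
  set X := star (α • w) ⬝ᵥ B *ᵥ z + star z ⬝ᵥ B *ᵥ (α • w) with hX
  have hexp : star ψ ⬝ᵥ B *ᵥ ψ = star α * α * (star w ⬝ᵥ B *ᵥ w) + X + star z ⬝ᵥ B *ᵥ z := by
    obtain ⟨e1, -⟩ := form_norm_expand B horthα 1
    rw [hsplit, hX]
    push_cast at e1
    rw [one_mul, one_pow, one_mul] at e1
    rw [e1, RayleighBottom.star_smul_dotProduct_mulVec_smul]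
  -- bounds on the three pieces
  have hdiag_w : ‖star w ⬝ᵥ B *ᵥ w‖ ≤ h := by
    have := hBform w; rwa [hw1, Complex.one_re, mul_one] at this
  have hdiag_z : ‖star z ⬝ᵥ B *ᵥ z‖ ≤ h * β ^ 2 :=
    (hBform z).trans (mul_le_mul_of_nonneg_left hzβ hh)
  have hcross : ‖X‖ ≤ 2 * h * β := by
    rcases hβ.lt_or_eq with hβpos | hβ0
    · have hna : (star (α • w) ⬝ᵥ (α • w)).re = ‖α‖ ^ 2 := by
        rw [star_smul, smul_dotProduct, dotProduct_smul, smul_smul, hw1, smul_eq_mul, mul_one,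
          hss, Complex.ofReal_re]
      have hc := cross_term_bound hBform horthα (t := 1 / β) (by positivity)
      rw [← hX, hna] at hc
      calc ‖X‖ ≤ h * (‖α‖ ^ 2 / (1 / β) + 1 / β * (star z ⬝ᵥ z).re) := hc
        _ = h * (‖α‖ ^ 2 * β + (star z ⬝ᵥ z).re / β) := by
            congr 1
            field_simp
        _ ≤ h * (1 * β + β ^ 2 / β) := by
            refine mul_le_mul_of_nonneg_left (add_le_add ?_ ?_) hh
            · exact mul_le_mul_of_nonneg_right hα1 hβ
            · exact div_le_div_of_nonneg_right hzβ hβ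
        _ = 2 * h * β := by
            field_simp
            ring
    · -- `β = 0`: `z = 0`
      have hz0 : z = 0 := by
        by_contra hne
        have hle : (star z ⬝ᵥ z).re ≤ 0 := by rw [← hβ0] at hzβ; simpa using hzβ
        exact absurd hle (not_le.2 (re_star_dotProduct_self_pos hne))
      have : X = 0 := by rw [hX, hz0]; simp
      rw [this, norm_zero, ← hβ0]; simp
  -- assemble: `⟨ψ,Bψ⟩ - ⟨w,Bw⟩ = (|α|² - 1)⟨w,Bw⟩ + X + ⟨z,Bz⟩`
  have hkey : star ψ ⬝ᵥ B *ᵥ ψ - star w ⬝ᵥ B *ᵥ w =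
      (star α * α - 1) * (star w ⬝ᵥ B *ᵥ w) + X + star z ⬝ᵥ B *ᵥ z := by
    rw [hexp]; ring
  have hn1 : ‖(star α * α - 1) * (star w ⬝ᵥ B *ᵥ w)‖ ≤ β ^ 2 * h := by
    rw [norm_mul, hss, ← Complex.ofReal_one, ← Complex.ofReal_sub,
      Complex.norm_real, Real.norm_eq_abs, abs_sub_comm, abs_of_nonneg (by linarith)]
    exact mul_le_mul (by linarith) hdiag_w (norm_nonneg _) (sq_nonneg β)
  have htot : ‖star ψ ⬝ᵥ B *ᵥ ψ - star w ⬝ᵥ B *ᵥ w‖ ≤ 2 * h * (β + β ^ 2) := by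
    rw [hkey]
    refine (norm_add_le _ _).trans ((add_le_add (norm_add_le _ _) le_rfl).trans ?_)
    nlinarith [hn1, hcross, hdiag_z]
  exact (Complex.abs_re_le_norm _).trans htot


/-- **Sharper mixing bound with the observable residual** (the form used when `s_O = ‖(O - o) w‖`,
`o = ⟨w, O w⟩`, is computed exactly): for unit `ψ`, `w` with `1 - |⟨w, ψ⟩|² ≤ β²`, `0 ≤ β`, a
Hermitian `O` with `|⟨x, (O - m) x⟩| ≤ h ‖x‖²`, and `‖O w - o w‖² ≤ s_O²`, `0 ≤ s_O`:
`|Re ⟨ψ, O ψ⟩ - o| ≤ 2 β s_O + β² (h + |o - m|)` (the `⟨w, (O - o) w⟩` term vanishes, the cross term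
is `2 Re (α ⟨z, (O - o) w⟩) ≤ 2 β s_O` by Cauchy–Schwarz, and `|⟨z, (O - o) z⟩| ≤ (h + |o - m|) ‖z‖²`).
[folklore] -/
theorem abs_expect_sub_expect_le_of_residual {O : Matrix ι ι ℂ} (hO : Oᴴ = O) {m h β sO : ℝ}
    (hOform : ∀ x : ι → ℂ, ‖star x ⬝ᵥ O *ᵥ x - (m : ℂ) * (star x ⬝ᵥ x)‖ ≤ h * (star x ⬝ᵥ x).re)
    {ψ w : ι → ℂ} (hψ1 : star ψ ⬝ᵥ ψ = 1) (hw1 : star w ⬝ᵥ w = 1) (hβ : 0 ≤ β)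
    (hover : 1 - ‖star w ⬝ᵥ ψ‖ ^ 2 ≤ β ^ 2) (hsO : 0 ≤ sO)
    (hres : (star (O *ᵥ w - ((star w ⬝ᵥ O *ᵥ w).re : ℂ) • w) ⬝ᵥ
      (O *ᵥ w - ((star w ⬝ᵥ O *ᵥ w).re : ℂ) • w)).re ≤ sO ^ 2) :
    |(star ψ ⬝ᵥ O *ᵥ ψ).re - (star w ⬝ᵥ O *ᵥ w).re| ≤
      2 * β * sO + β ^ 2 * (h + |(star w ⬝ᵥ O *ᵥ w).re - m|) := by
  set o : ℝ := (star w ⬝ᵥ O *ᵥ w).re with ho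
  have hoC : star w ⬝ᵥ O *ᵥ w = (o : ℂ) := star_dotProduct_mulVec_self_eq_re hO w
  -- `B = O - o`, `y = B w`
  set B : Matrix ι ι ℂ := O - (o : ℂ) • (1 : Matrix ι ι ℂ) with hBdef
  have hBx : ∀ x : ι → ℂ, B *ᵥ x = O *ᵥ x - (o : ℂ) • x := fun x => by
    rw [hBdef, sub_mulVec, smul_mulVec, one_mulVec]
  have hBH : Bᴴ = B := by
    rw [hBdef, conjTranspose_sub, conjTranspose_smul, conjTranspose_one, hO, Complex.star_def,
      Complex.conj_ofReal]
  have hBO : ∀ x : ι → ℂ, star x ⬝ᵥ B *ᵥ x = star x ⬝ᵥ O *ᵥ x - (o : ℂ) * (star x ⬝ᵥ x) := fun x => by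
    rw [hBx, dotProduct_sub, dotProduct_smul, smul_eq_mul]
  have hBw : star w ⬝ᵥ B *ᵥ w = 0 := by rw [hBO, hoC, hw1, mul_one, sub_self]
  have hh : 0 ≤ h := by
    have := hOform ψ
    simp only [hψ1, Complex.one_re, mul_one] at this
    exact (norm_nonneg _).trans this
  -- form bound for `B`: `|⟨x, B x⟩| ≤ (h + |o - m|) ‖x‖²`
  have hBform : ∀ x : ι → ℂ, ‖star x ⬝ᵥ B *ᵥ x‖ ≤ (h + |o - m|) * (star x ⬝ᵥ x).re := by
    intro x
    have e : star x ⬝ᵥ B *ᵥ x =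
        (star x ⬝ᵥ O *ᵥ x - (m : ℂ) * (star x ⬝ᵥ x)) + ((m - o : ℝ) : ℂ) * (star x ⬝ᵥ x) := by
      rw [hBO]; push_cast; ring
    rw [e]
    refine (norm_add_le _ _).trans ?_
    have hn2 : ‖((m - o : ℝ) : ℂ) * (star x ⬝ᵥ x)‖ = |o - m| * (star x ⬝ᵥ x).re := by
      rw [norm_mul, Complex.norm_real, Real.norm_eq_abs, abs_sub_comm, norm_star_dotProduct_self]
    rw [hn2, add_mul]
    exact add_le_add (hOform x) le_rfl
  -- reduce the claim to `B`
  have hred : (star ψ ⬝ᵥ O *ᵥ ψ).re - o = (star ψ ⬝ᵥ B *ᵥ ψ).re := by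
    rw [hBO, hψ1, mul_one, Complex.sub_re, Complex.ofReal_re]
  rw [hred]
  -- split `ψ = α w + z`
  obtain ⟨hz, hsplit, hnz⟩ := unit_split hψ1 hw1
  set α : ℂ := star w ⬝ᵥ ψ with hα
  set z : ι → ℂ := ψ - α • w with hzdef
  have hzβ : (star z ⬝ᵥ z).re ≤ β ^ 2 := by rw [hnz]; exact hover
  have hα1 : ‖α‖ ^ 2 ≤ 1 := by
    have := re_star_dotProduct_self_nonneg z
    rw [hnz] at this; linarith
  have horthα : star (α • w) ⬝ᵥ z = 0 := by rw [star_smul, smul_dotProduct, hz, smul_zero]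
  set X := star (α • w) ⬝ᵥ B *ᵥ z + star z ⬝ᵥ B *ᵥ (α • w) with hX
  have hexp : star ψ ⬝ᵥ B *ᵥ ψ = X + star z ⬝ᵥ B *ᵥ z := by
    obtain ⟨e1, -⟩ := form_norm_expand B horthα 1
    rw [hsplit, hX]
    push_cast at e1
    rw [one_mul, one_pow, one_mul] at e1
    rw [e1, RayleighBottom.star_smul_dotProduct_mulVec_smul, hBw, mul_zero, zero_add]
  -- the cross term: `X = conj c + c` with `c = α ⟨z, B w⟩`, `|c| ≤ β s_O`
  have hc : star z ⬝ᵥ B *ᵥ (α • w) = α * (star z ⬝ᵥ B *ᵥ w) := by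
    rw [mulVec_smul, dotProduct_smul, smul_eq_mul]
  have hX2 : X = star (α * (star z ⬝ᵥ B *ᵥ w)) + α * (star z ⬝ᵥ B *ᵥ w) := by
    rw [hX, hc, star_dotProduct_mulVec_comm hBH (α • w) z, hc]
  have hy : (star (B *ᵥ w) ⬝ᵥ (B *ᵥ w)).re ≤ sO ^ 2 := by
    rw [hBx w]
    exact hres
  have hcs : ‖star z ⬝ᵥ B *ᵥ w‖ ^ 2 ≤ β ^ 2 * sO ^ 2 :=
    (norm_star_dotProduct_sq_le z (B *ᵥ w)).trans
      (mul_le_mul hzβ hy (re_star_dotProduct_self_nonneg _) (sq_nonneg β))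
  have hcs' : ‖star z ⬝ᵥ B *ᵥ w‖ ≤ β * sO := by
    have h0 : 0 ≤ β * sO := mul_nonneg hβ hsO
    nlinarith [norm_nonneg (star z ⬝ᵥ B *ᵥ w), hcs, sq_nonneg (‖star z ⬝ᵥ B *ᵥ w‖ - β * sO)]
  have hcross : ‖X‖ ≤ 2 * β * sO := by
    rw [hX2]
    refine (norm_add_le _ _).trans ?_
    rw [norm_star, norm_mul, two_mul, add_mul]
    have hα' : ‖α‖ ≤ 1 := by nlinarith [norm_nonneg α, hα1]
    have : ‖α‖ * ‖star z ⬝ᵥ B *ᵥ w‖ ≤ β * sO := by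
      calc ‖α‖ * ‖star z ⬝ᵥ B *ᵥ w‖ ≤ 1 * ‖star z ⬝ᵥ B *ᵥ w‖ :=
            mul_le_mul_of_nonneg_right hα' (norm_nonneg _)
        _ ≤ β * sO := by rw [one_mul]; exact hcs'
    linarith
  have hdiag_z : ‖star z ⬝ᵥ B *ᵥ z‖ ≤ (h + |o - m|) * β ^ 2 :=
    (hBform z).trans (mul_le_mul_of_nonneg_left hzβ (by positivity))
  have htot : ‖star ψ ⬝ᵥ B *ᵥ ψ‖ ≤ 2 * β * sO + β ^ 2 * (h + |o - m|) := by
    rw [hexp]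
    refine (norm_add_le _ _).trans ?_
    nlinarith [hcross, hdiag_z]
  exact (Complex.abs_re_le_norm _).trans htot

/-! ### Certificate shapes for the gap hypothesis -/

/-- The `LDLᴴ` form is nonnegative on the hyperplane `(Lᴴ y)_j = 0` when all pivots but the `j`-th
are `≥ 0`: `Re ⟨y, L D Lᴴ y⟩ = Σ_i d_i |(Lᴴ y)_i|² ≥ 0`. (The `j`-th column of `L` is the normal of
the hyperplane: `(Lᴴ y)_j = ⟨L e_j, y⟩`.) Golub–Van Loan (2013) §8.1.5 / §8.4.2. [folklore] -/
theorem re_ldl_form_nonneg {κ : Type*} [Fintype κ] [DecidableEq κ] (L : Matrix κ κ ℂ) {d : κ → ℝ}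
    (j : κ) (hd : ∀ i, i ≠ j → 0 ≤ d i) (y : κ → ℂ) (hy : star (fun i => L i j) ⬝ᵥ y = 0) :
    0 ≤ (star y ⬝ᵥ (L * diagonal (fun i => (d i : ℂ)) * Lᴴ) *ᵥ y).re := by
  have hss : ∀ a : ℂ, star a * a = ((‖a‖ ^ 2 : ℝ) : ℂ) := fun a => by
    rw [Complex.star_def, ← Complex.normSq_eq_conj_mul_self, Complex.normSq_eq_norm_sq]
  have hyj : (Lᴴ *ᵥ y) j = 0 := by
    rw [← hy]
    simp [mulVec, dotProduct, conjTranspose_apply]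
  rw [← mulVec_mulVec, ← mulVec_mulVec, RayleighBottom.star_dotProduct_mulVec_eq]
  set u := Lᴴ *ᵥ y with hu
  have hsum : star u ⬝ᵥ diagonal (fun i => (d i : ℂ)) *ᵥ u = ∑ i, ((d i * ‖u i‖ ^ 2 : ℝ) : ℂ) := by
    simp only [dotProduct, mulVec_diagonal, Pi.star_apply]
    refine Finset.sum_congr rfl fun i _ => ?_
    rw [mul_left_comm, hss, ← Complex.ofReal_mul]
  rw [hsum, ← Complex.ofReal_sum, Complex.ofReal_re]
  refine Finset.sum_nonneg fun i _ => ?_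
  by_cases hij : i = j
  · rw [hij, hyj, norm_zero]; simp
  · exact mul_nonneg (hd i hij) (sq_nonneg _)

/-- **`LDLᴴ` (inertia) certificate for the second eigenvalue.** If `A - σ·1 = L D Lᴴ` with real pivots
`d_i ≥ 0` for all `i ≠ j` (at most ONE negative pivot), then `Re ⟨x, A x⟩ ≥ σ ‖x‖²` on the hyperplane
orthogonal to the `j`-th column of `L`. With `gap_of_codimOne_certificate`
(`exists_codimOne_of_vector_certificate`) this is "`λ₂(A) ≥ σ`". Sylvester's law of inertia,
Golub–Van Loan (2013) Thm 8.1.17 and §8.4.2 (number of negative pivots of `A - μ I = LDLᵀ` = number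
of eigenvalues `< μ`); only the easy direction is needed and `L` need not be invertible.
[cite: GolubVanLoan2013, §8.1.5 Thm 8.1.17; §8.4.2] -/
theorem form_ge_of_ldl_certificate {A L : Matrix ι ι ℂ} {d : ι → ℝ} {σ : ℝ} (j : ι)
    (hfac : A - (σ : ℂ) • (1 : Matrix ι ι ℂ) = L * diagonal (fun i => (d i : ℂ)) * Lᴴ)
    (hd : ∀ i, i ≠ j → 0 ≤ d i) (x : ι → ℂ) (hx : star (fun i => L i j) ⬝ᵥ x = 0) :
    σ * (star x ⬝ᵥ x).re ≤ (star x ⬝ᵥ A *ᵥ x).re := by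
  have h := re_ldl_form_nonneg L j hd x hx
  rw [← hfac, sub_mulVec, smul_mulVec, one_mulVec, dotProduct_sub, dotProduct_smul, smul_eq_mul,
    Complex.sub_re, Complex.re_ofReal_mul] at h
  linarith

/-- **Rank-one-shifted PSD certificate for the second eigenvalue.** If `A - σ·1 + c · u uᴴ ⪰ 0`
(e.g. a successful Cholesky factorisation of the shifted matrix plus a rank-one term), then
`Re ⟨x, A x⟩ ≥ σ ‖x‖²` for every `x ⊥ u`; with `gap_of_codimOne_certificate` this is "`λ₂(A) ≥ σ`"
(interlacing under a rank-one perturbation, Horn–Johnson (2013) §4.3; Golub–Van Loan (2013)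
Thm 8.1.8). [folklore] -/
theorem form_ge_of_rankOne_certificate {A : Matrix ι ι ℂ} {u : ι → ℂ} {σ : ℝ} {c : ℂ}
    (hP : (A - (σ : ℂ) • (1 : Matrix ι ι ℂ) + c • vecMulVec u (star u)).PosSemidef)
    (x : ι → ℂ) (hx : star u ⬝ᵥ x = 0) : σ * (star x ⬝ᵥ x).re ≤ (star x ⬝ᵥ A *ᵥ x).re := by
  have h := hP.dotProduct_mulVec_nonneg x
  rw [add_mulVec, smul_mulVec, vecMulVec_mulVec, hx, MulOpposite.op_zero, zero_smul, smul_zero,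
    add_zero, sub_mulVec, smul_mulVec, one_mulVec, dotProduct_sub, dotProduct_smul, smul_eq_mul] at h
  obtain ⟨hre, -⟩ := Complex.nonneg_iff.mp h
  rw [Complex.sub_re, Complex.re_ofReal_mul] at hre
  linarith

omit [DecidableEq ι] in
/-- From a form bound on `K ∩ v^⊥` to the data `(W, u)` of `gap_of_codimOne_certificate`:
`W = K ∩ v^⊥`, `u` any vector of `K` with `⟨v, u⟩ ≠ 0` (or `0` if there is none). [folklore] -/
theorem exists_codimOne_of_vector_certificate {A : Matrix ι ι ℂ} (K : Submodule ℂ (ι → ℂ))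
    (v : ι → ℂ) {σ : ℝ}
    (hv : ∀ x ∈ K, star v ⬝ᵥ x = 0 → σ * (star x ⬝ᵥ x).re ≤ (star x ⬝ᵥ A *ᵥ x).re) :
    ∃ (W : Submodule ℂ (ι → ℂ)) (u : ι → ℂ),
      (∀ z ∈ W, σ * (star z ⬝ᵥ z).re ≤ (star z ⬝ᵥ A *ᵥ z).re) ∧
      (∀ x ∈ K, ∃ z ∈ W, ∃ c : ℂ, x = z + c • u) := by
  let ℓ : (ι → ℂ) →ₗ[ℂ] ℂ :=
    { toFun := fun x => star v ⬝ᵥ x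
      map_add' := fun x y => dotProduct_add (star v) x y
      map_smul' := fun c x => by rw [dotProduct_smul, RingHom.id_apply] }
  have hℓ : ∀ x, ℓ x = star v ⬝ᵥ x := fun x => rfl
  have hWform : ∀ z ∈ K ⊓ LinearMap.ker ℓ, σ * (star z ⬝ᵥ z).re ≤ (star z ⬝ᵥ A *ᵥ z).re := by
    intro z hz
    obtain ⟨hzK, hzℓ⟩ := Submodule.mem_inf.1 hz
    exact hv z hzK (by rw [← hℓ]; exact LinearMap.mem_ker.1 hzℓ)
  by_cases h : ∃ u ∈ K, star v ⬝ᵥ u ≠ 0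
  · obtain ⟨u, huK, hu⟩ := h
    refine ⟨K ⊓ LinearMap.ker ℓ, u, hWform, fun x hxK => ?_⟩
    refine ⟨x - (star v ⬝ᵥ x / star v ⬝ᵥ u) • u, Submodule.mem_inf.2 ⟨?_, ?_⟩,
      star v ⬝ᵥ x / star v ⬝ᵥ u, by abel⟩
    · exact K.sub_mem hxK (K.smul_mem _ huK)
    · rw [LinearMap.mem_ker, hℓ, dotProduct_sub, dotProduct_smul, smul_eq_mul,
        div_mul_cancel₀ _ hu, sub_self]
  · push Not at h
    refine ⟨K ⊓ LinearMap.ker ℓ, 0, hWform, fun x hxK => ⟨x, Submodule.mem_inf.2 ⟨hxK, ?_⟩, 0, by simp⟩⟩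
    rw [LinearMap.mem_ker, hℓ]
    exact h x hxK

/-! ### Frame (symmetry-adapted basis) versions of the certificates -/

section Frame

variable {κ : Type*} [Fintype κ]

omit [DecidableEq ι] in
/-- Compression of a form along a frame: `⟨Φ y, M (Φ y)⟩ = ⟨y, (Φᴴ M Φ) y⟩`. [folklore] -/
theorem frame_form (Φ : Matrix ι κ ℂ) (M : Matrix ι ι ℂ) (y : κ → ℂ) :
    star (Φ *ᵥ y) ⬝ᵥ M *ᵥ (Φ *ᵥ y) = star y ⬝ᵥ (Φᴴ * M * Φ) *ᵥ y := by
  rw [star_mulVec, mulVec_mulVec, dotProduct_mulVec, vecMul_vecMul, ← dotProduct_mulVec,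
    Matrix.mul_assoc]

omit [DecidableEq ι] in
/-- Gram form of a frame: `⟨Φ y, Φ y⟩ = ⟨y, (Φᴴ Φ) y⟩`. [folklore] -/
theorem frame_norm (Φ : Matrix ι κ ℂ) (y : κ → ℂ) :
    star (Φ *ᵥ y) ⬝ᵥ (Φ *ᵥ y) = star y ⬝ᵥ (Φᴴ * Φ) *ᵥ y := by
  rw [star_mulVec, dotProduct_mulVec, vecMul_vecMul, ← dotProduct_mulVec]

omit [DecidableEq ι] in
/-- **Frame `LDLᴴ` certificate**: for a frame `Φ` (columns spanning the sector; not necessarily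
orthonormal or independent) with compressed matrix `M = Φᴴ A Φ` and Gram matrix `G = Φᴴ Φ`, a
factorisation `M - σ G = L D Lᴴ` with all pivots but the `j`-th `≥ 0` gives
`Re ⟨Φ y, A Φ y⟩ ≥ σ ‖Φ y‖²` on the hyperplane `(Lᴴ y)_j = 0`. [folklore] -/
theorem frame_form_ge_of_ldl_certificate [DecidableEq κ] {A : Matrix ι ι ℂ} (Φ : Matrix ι κ ℂ)
    {L : Matrix κ κ ℂ} {d : κ → ℝ} {σ : ℝ} (j : κ)
    (hfac : Φᴴ * A * Φ - (σ : ℂ) • (Φᴴ * Φ) = L * diagonal (fun i => (d i : ℂ)) * Lᴴ)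
    (hd : ∀ i, i ≠ j → 0 ≤ d i) (y : κ → ℂ) (hy : star (fun i => L i j) ⬝ᵥ y = 0) :
    σ * (star (Φ *ᵥ y) ⬝ᵥ (Φ *ᵥ y)).re ≤ (star (Φ *ᵥ y) ⬝ᵥ A *ᵥ (Φ *ᵥ y)).re := by
  have h := re_ldl_form_nonneg L j hd y hy
  rw [← hfac, sub_mulVec, smul_mulVec, dotProduct_sub, dotProduct_smul, smul_eq_mul, ← frame_form,
    ← frame_norm, Complex.sub_re, Complex.re_ofReal_mul] at h
  linarith

omit [DecidableEq ι] in
/-- **Frame rank-one certificate**: `Φᴴ A Φ - σ Φᴴ Φ + c u uᴴ ⪰ 0` gives `Re ⟨Φ y, A Φ y⟩ ≥ σ ‖Φ y‖²`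
for `y ⊥ u`. [folklore] -/
theorem frame_form_ge_of_rankOne_certificate {A : Matrix ι ι ℂ} (Φ : Matrix ι κ ℂ)
    {u : κ → ℂ} {σ : ℝ} {c : ℂ}
    (hP : (Φᴴ * A * Φ - (σ : ℂ) • (Φᴴ * Φ) + c • vecMulVec u (star u)).PosSemidef)
    (y : κ → ℂ) (hy : star u ⬝ᵥ y = 0) :
    σ * (star (Φ *ᵥ y) ⬝ᵥ (Φ *ᵥ y)).re ≤ (star (Φ *ᵥ y) ⬝ᵥ A *ᵥ (Φ *ᵥ y)).re := by
  have h := hP.dotProduct_mulVec_nonneg y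
  rw [add_mulVec, smul_mulVec, vecMulVec_mulVec, hy, MulOpposite.op_zero, zero_smul, smul_zero,
    add_zero, sub_mulVec, smul_mulVec, dotProduct_sub, dotProduct_smul, smul_eq_mul, ← frame_form,
    ← frame_norm] at h
  obtain ⟨hre, -⟩ := Complex.nonneg_iff.mp h
  rw [Complex.sub_re, Complex.re_ofReal_mul] at hre
  linarith

omit [DecidableEq ι] in
/-- From a frame certificate to the data `(W, u)` of `gap_of_codimOne_certificate`: if every vector
of `K` is `Φ y` for some coordinates `y` and the bound holds for `Φ y` on the coordinate hyperplane
`v^⊥`, take `W = Φ(v^⊥)` and `u = Φ y₀` with `⟨v, y₀⟩ ≠ 0` (or `u = 0`). [folklore] -/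
theorem exists_codimOne_of_frame_certificate {A : Matrix ι ι ℂ} (K : Submodule ℂ (ι → ℂ))
    (Φ : Matrix ι κ ℂ) (hK : ∀ x ∈ K, ∃ y : κ → ℂ, Φ *ᵥ y = x) (v : κ → ℂ) {σ : ℝ}
    (hv : ∀ y : κ → ℂ, star v ⬝ᵥ y = 0 →
      σ * (star (Φ *ᵥ y) ⬝ᵥ (Φ *ᵥ y)).re ≤ (star (Φ *ᵥ y) ⬝ᵥ A *ᵥ (Φ *ᵥ y)).re) :
    ∃ (W : Submodule ℂ (ι → ℂ)) (u : ι → ℂ),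
      (∀ z ∈ W, σ * (star z ⬝ᵥ z).re ≤ (star z ⬝ᵥ A *ᵥ z).re) ∧
      (∀ x ∈ K, ∃ z ∈ W, ∃ c : ℂ, x = z + c • u) := by
  let ℓ : (κ → ℂ) →ₗ[ℂ] ℂ :=
    { toFun := fun y => star v ⬝ᵥ y
      map_add' := fun x y => dotProduct_add (star v) x y
      map_smul' := fun c x => by rw [dotProduct_smul, RingHom.id_apply] }
  have hℓ : ∀ y, ℓ y = star v ⬝ᵥ y := fun y => rfl
  set W : Submodule ℂ (ι → ℂ) := (LinearMap.ker ℓ).map (Matrix.mulVecLin Φ) with hW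
  have hWform : ∀ z ∈ W, σ * (star z ⬝ᵥ z).re ≤ (star z ⬝ᵥ A *ᵥ z).re := by
    intro z hz
    obtain ⟨y, hy, rfl⟩ := Submodule.mem_map.1 hz
    rw [Matrix.mulVecLin_apply]
    exact hv y (by rw [← hℓ]; exact LinearMap.mem_ker.1 hy)
  by_cases h : ∃ y₀, star v ⬝ᵥ y₀ ≠ 0
  · obtain ⟨y₀, hy₀⟩ := h
    refine ⟨W, Φ *ᵥ y₀, hWform, fun x hxK => ?_⟩
    obtain ⟨y, rfl⟩ := hK x hxK
    refine ⟨Φ *ᵥ (y - (star v ⬝ᵥ y / star v ⬝ᵥ y₀) • y₀), ?_, star v ⬝ᵥ y / star v ⬝ᵥ y₀, ?_⟩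
    · refine Submodule.mem_map.2 ⟨_, ?_, (Matrix.mulVecLin_apply _ _)⟩
      rw [LinearMap.mem_ker, hℓ, dotProduct_sub, dotProduct_smul, smul_eq_mul,
        div_mul_cancel₀ _ hy₀, sub_self]
    · rw [mulVec_sub, mulVec_smul, sub_add_cancel]
  · push Not at h
    refine ⟨W, 0, hWform, fun x hxK => ?_⟩
    obtain ⟨y, rfl⟩ := hK x hxK
    refine ⟨Φ *ᵥ y, Submodule.mem_map.2 ⟨y, ?_, Matrix.mulVecLin_apply _ _⟩, 0, by simp⟩
    rw [LinearMap.mem_ker, hℓ]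
    exact h y

end Frame

/-! ### Simplicity ⇒ the tracial sector ground state is the vector state -/

/-- If the sector ground multiplet `K ∩ ker (A - e)`, `e = minEnergyOn A K`, is the line through a
unit vector `ψ`, then it is one-dimensional and the tracial sector ground state
`projState (sectorGroundProj A K)` is `O ↦ ⟨ψ, O ψ⟩`. Tasaki (2020) §2.1 (unique ground state).
[folklore] -/
theorem projState_sectorGroundProj_eq {A : Matrix ι ι ℂ} (K : Submodule ℂ (ι → ℂ)) {ψ : ι → ℂ}
    (hψK : ψ ∈ K) (hψ1 : star ψ ⬝ᵥ ψ = 1)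
    (hAψ : A *ᵥ ψ = ((A.minEnergyOn K : ℝ) : ℂ) • ψ)
    (huniq : ∀ φ ∈ K, A *ᵥ φ = ((A.minEnergyOn K : ℝ) : ℂ) • φ → φ = (star ψ ⬝ᵥ φ) • ψ) :
    Module.finrank ℂ (A.sectorGroundSpace K) = 1 ∧
      ∀ O : Matrix ι ι ℂ, (A.sectorGroundProj K).projState O = star ψ ⬝ᵥ O *ᵥ ψ := by
  have hψE : ψ ∈ A.sectorGroundSpace K := (Matrix.mem_sectorGroundSpace_iff A K ψ).2 ⟨hψK, hAψ⟩
  have hψ0 : ψ ≠ 0 := by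
    rintro rfl
    rw [dotProduct_zero] at hψ1
    exact zero_ne_one hψ1
  have hne : (⟨ψ, hψE⟩ : A.sectorGroundSpace K) ≠ 0 := by
    intro h
    exact hψ0 (by simpa using congrArg Subtype.val h)
  have hfin : Module.finrank ℂ (A.sectorGroundSpace K) = 1 := by
    refine (finrank_eq_one_iff_of_nonzero' _ hne).2 fun φ => ?_
    obtain ⟨hφK, hAφ⟩ := (Matrix.mem_sectorGroundSpace_iff A K φ.1).1 φ.2
    exact ⟨star ψ ⬝ᵥ φ.1, Subtype.ext (huniq φ.1 hφK hAφ).symm⟩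
  refine ⟨hfin, fun O => ?_⟩
  obtain ⟨k, b, hk, hbE, hb1, htr⟩ := exists_frame_trace_projMatrix_map_mul (A.sectorGroundSpace K)
  rw [hfin] at hk
  subst hk
  -- the single frame vector is a phase times `ψ`
  obtain ⟨hb0K, hAb0⟩ := (Matrix.mem_sectorGroundSpace_iff A K (b 0)).1 (hbE 0)
  have hb0 : b 0 = (star ψ ⬝ᵥ b 0) • ψ := huniq (b 0) hb0K hAb0
  set c : ℂ := star ψ ⬝ᵥ b 0 with hc
  have hcc : star c * c = 1 := by
    have h := hb1 0
    rw [hb0, star_smul, smul_dotProduct, dotProduct_smul, hψ1, smul_eq_mul, smul_eq_mul, mul_one] at h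
    exact h
  have htrO : (A.sectorGroundProj K * O).trace = star ψ ⬝ᵥ O *ᵥ ψ := by
    rw [Matrix.sectorGroundProj, htr O, Fin.sum_univ_one, hb0,
      RayleighBottom.star_smul_dotProduct_mulVec_smul, hcc, one_mul]
  have htr1 : (A.sectorGroundProj K).trace = 1 := by
    have h := htr 1
    rw [Matrix.mul_one, Fin.sum_univ_one, one_mulVec, hb1 0] at h
    exact h
  rw [Matrix.projState_apply, htrO, htr1, inv_one, one_mul]

/-! ### Packaged enclosures -/

omit [DecidableEq ι] in
/-- **Sector enclosure from one trial vector and a gap certificate.** Let `A` be Hermitian and `K` an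
`A`-invariant subspace; let `Re ⟨z, A z⟩ ≥ σ ‖z‖²` on a subspace `W` with `K ≤ W + ℂ u`
(`form_ge_of_ldl_certificate` / `form_ge_of_rankOne_certificate` / frame versions, via
`exists_codimOne_of_*_certificate`); let `w ∈ K` be a unit vector with `Re ⟨w, A w⟩ = ρ < σ` and
`‖A w‖² ≤ r² + ρ²`. Then with `e = minEnergyOn A K`:
(i) `ρ - r²/(σ - ρ) ≤ e ≤ ρ` (Kato–Temple + variational principle);
(ii) there is a unit `ψ ∈ K` with `A ψ = e ψ`, every `e`-eigenvector in `K` is a multiple of `ψ`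
(simple sector ground state), `Re ⟨z, A z⟩ ≥ σ ‖z‖²` on `K ∩ ψ^⊥`, and
(iii) `(1 - |⟨ψ, w⟩|²)(σ - ρ)² ≤ r²` (`sin ∠(ψ, w) ≤ r/(σ - ρ)`).
Saad (1992) Ch. III Thm 3.8, Thm 3.9. [cite: Saad1992, Ch. III §3.2 Thm 3.8–3.9] -/
theorem sector_enclosure {A : Matrix ι ι ℂ} (hA : A.IsHermitian) (K : Submodule ℂ (ι → ℂ))
    (hKA : ∀ v ∈ K, A *ᵥ v ∈ K) {W : Submodule ℂ (ι → ℂ)} {u : ι → ℂ} {σ : ℝ}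
    (hW : ∀ z ∈ W, σ * (star z ⬝ᵥ z).re ≤ (star z ⬝ᵥ A *ᵥ z).re)
    (hWK : ∀ x ∈ K, ∃ z ∈ W, ∃ c : ℂ, x = z + c • u)
    {w : ι → ℂ} (hwK : w ∈ K) (hw1 : star w ⬝ᵥ w = 1) {ρ r2 : ℝ}
    (hρ : (star w ⬝ᵥ A *ᵥ w).re = ρ) (hr2 : (star (A *ᵥ w) ⬝ᵥ A *ᵥ w).re ≤ r2 + ρ ^ 2)
    (hρσ : ρ < σ) :
    ρ - r2 / (σ - ρ) ≤ A.minEnergyOn K ∧ A.minEnergyOn K ≤ ρ ∧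
      ∃ ψ ∈ K, star ψ ⬝ᵥ ψ = 1 ∧ A *ᵥ ψ = ((A.minEnergyOn K : ℝ) : ℂ) • ψ ∧
        (∀ φ ∈ K, A *ᵥ φ = ((A.minEnergyOn K : ℝ) : ℂ) • φ → φ = (star ψ ⬝ᵥ φ) • ψ) ∧
        (∀ z ∈ K, star ψ ⬝ᵥ z = 0 → σ * (star z ⬝ᵥ z).re ≤ (star z ⬝ᵥ A *ᵥ z).re) ∧
        (1 - ‖star ψ ⬝ᵥ w‖ ^ 2) * (σ - ρ) ^ 2 ≤ r2 := by
  have hw0 : w ≠ 0 := by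
    rintro rfl
    rw [dotProduct_zero] at hw1
    exact zero_ne_one hw1
  have hK : K ≠ ⊥ := fun h => hw0 ((Submodule.mem_bot ℂ).1 (h ▸ hwK))
  obtain ⟨ψ, hψK, hψ1, hAψ⟩ := exists_unit_eigen_minEnergyOn hA K hKA hK
  have heρ : A.minEnergyOn K ≤ ρ := by
    have h := minEnergyOn_mul_le_re_rayleigh hA K hwK
    rw [hw1, Complex.one_re, mul_one, hρ] at h
    exact h
  have heσ : A.minEnergyOn K < σ := heρ.trans_lt hρσ
  have hgap : ∀ z ∈ K, star ψ ⬝ᵥ z = 0 → σ * (star z ⬝ᵥ z).re ≤ (star z ⬝ᵥ A *ᵥ z).re :=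
    fun z hzK hz => gap_of_codimOne_certificate hA.eq hW hWK hψK hψ1 hAψ heσ hzK hz
  have hσρ : 0 < σ - ρ := sub_pos.2 hρσ
  have htc := temple_core hA.eq hψK hψ1 hAψ heσ hgap hwK
  rw [hw1, Complex.one_re, mul_one, hρ] at htc
  -- (i) Kato–Temple
  have h1 : ρ - r2 / (σ - ρ) ≤ A.minEnergyOn K := by
    have : ρ - A.minEnergyOn K ≤ r2 / (σ - ρ) := by
      rw [le_div_iff₀ hσρ]
      nlinarith
    linarith
  -- (iii) eigenvector bound
  have hsin := sin_sq_mul_gap_le hA.eq hψ1 hAψ hψK hgap hwK hw1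
  rw [hρ] at hsin
  have hcos : 0 ≤ 1 - ‖star ψ ⬝ᵥ w‖ ^ 2 := by
    have h := norm_star_dotProduct_sq_le ψ w
    rw [hψ1, hw1, Complex.one_re, mul_one] at h
    linarith
  have h3 : (1 - ‖star ψ ⬝ᵥ w‖ ^ 2) * (σ - ρ) ^ 2 ≤ r2 := by
    have hσe : σ - ρ ≤ σ - A.minEnergyOn K := by linarith
    calc (1 - ‖star ψ ⬝ᵥ w‖ ^ 2) * (σ - ρ) ^ 2
        = (1 - ‖star ψ ⬝ᵥ w‖ ^ 2) * (σ - ρ) * (σ - ρ) := by ring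
      _ ≤ (1 - ‖star ψ ⬝ᵥ w‖ ^ 2) * (σ - A.minEnergyOn K) * (σ - ρ) :=
          mul_le_mul_of_nonneg_right (mul_le_mul_of_nonneg_left hσe hcos) hσρ.le
      _ ≤ (ρ - A.minEnergyOn K) * (σ - ρ) := mul_le_mul_of_nonneg_right hsin hσρ.le
      _ ≤ r2 := by nlinarith
  exact ⟨h1, heρ, ψ, hψK, hψ1, hAψ,
    fun φ hφK hAφ => eq_smul_of_eigen hψ1 hAψ hψK heσ hgap hφK hAφ, hgap, h3⟩

/-- **Certified interval for a sector ground-state expectation.** In the situation of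
`sector_enclosure`, for a Hermitian observable `O` with `|⟨x, (O - m) x⟩| ≤ h ‖x‖²` and any `β ≥ 0`
with `r² ≤ β² (σ - ρ)²` (so `sin ∠ ≤ β`): the tracial sector ground state `ω = projState
(sectorGroundProj A K)` (which is the vector state of the unique sector ground state) satisfies
`|Re ω(O) - Re ⟨w, O w⟩| ≤ 2 h (β + β²)`. This is the soundness statement of the "Temple + mixing"
correlator enclosures (double occupancy, `S_zz(π,π)`, `C_zz(r)`: diagonal `O` with known range).
Ingredients: Saad (1992) Ch. III §3.2 Thms 3.8–3.9. [cite: Saad1992, Ch. III §3.2 Thm 3.8–3.9] -/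
theorem sector_expectation_enclosure {A : Matrix ι ι ℂ} (hA : A.IsHermitian)
    (K : Submodule ℂ (ι → ℂ)) (hKA : ∀ v ∈ K, A *ᵥ v ∈ K) {W : Submodule ℂ (ι → ℂ)} {u : ι → ℂ}
    {σ : ℝ} (hW : ∀ z ∈ W, σ * (star z ⬝ᵥ z).re ≤ (star z ⬝ᵥ A *ᵥ z).re)
    (hWK : ∀ x ∈ K, ∃ z ∈ W, ∃ c : ℂ, x = z + c • u)
    {w : ι → ℂ} (hwK : w ∈ K) (hw1 : star w ⬝ᵥ w = 1) {ρ r2 : ℝ}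
    (hρ : (star w ⬝ᵥ A *ᵥ w).re = ρ) (hr2 : (star (A *ᵥ w) ⬝ᵥ A *ᵥ w).re ≤ r2 + ρ ^ 2)
    (hρσ : ρ < σ) {O : Matrix ι ι ℂ} {m h β : ℝ}
    (hOform : ∀ x : ι → ℂ, ‖star x ⬝ᵥ O *ᵥ x - (m : ℂ) * (star x ⬝ᵥ x)‖ ≤ h * (star x ⬝ᵥ x).re)
    (hβ : 0 ≤ β) (hβr : r2 ≤ β ^ 2 * (σ - ρ) ^ 2) :
    |((A.sectorGroundProj K).projState O).re - (star w ⬝ᵥ O *ᵥ w).re| ≤ 2 * h * (β + β ^ 2) := by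
  obtain ⟨-, -, ψ, hψK, hψ1, hAψ, huniq, -, hsin⟩ :=
    sector_enclosure hA K hKA hW hWK hwK hw1 hρ hr2 hρσ
  obtain ⟨-, hstate⟩ := projState_sectorGroundProj_eq K hψK hψ1 hAψ huniq
  rw [hstate O]
  have hσρ : 0 < (σ - ρ) ^ 2 := by have := sub_pos.2 hρσ; positivity
  have hover : 1 - ‖star w ⬝ᵥ ψ‖ ^ 2 ≤ β ^ 2 := by
    have hsym : ‖star w ⬝ᵥ ψ‖ = ‖star ψ ⬝ᵥ w‖ := by
      rw [star_dotProduct, norm_star]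
    rw [hsym]
    exact le_of_mul_le_mul_right (hsin.trans hβr) hσρ
  exact abs_expect_sub_expect_le hOform hψ1 hw1 hβ hover

omit [DecidableEq ι] in
/-- **Unnormalised trial vector** (the inputs of an exact-rational certificate): with the exact numbers
`N = ⟨w, w⟩ > 0`, `⟨w, A w⟩ = ρ N`, `⟨A w, A w⟩ ≤ (r² + ρ²) N` of a (typically integer) vector `w ∈ K`,
`ρ < σ` and a gap certificate `(W, u)` as in `sector_enclosure`:
`ρ - r²/(σ - ρ) ≤ minEnergyOn A K ≤ ρ`, and the sector ground state is simple with a unit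
eigenvector `ψ ∈ K` such that `(N - |⟨ψ, w⟩|²)(σ - ρ)² ≤ r² N`. [folklore] -/
theorem sector_enclosure_of_sums {A : Matrix ι ι ℂ} (hA : A.IsHermitian) (K : Submodule ℂ (ι → ℂ))
    (hKA : ∀ v ∈ K, A *ᵥ v ∈ K) {W : Submodule ℂ (ι → ℂ)} {u : ι → ℂ} {σ : ℝ}
    (hW : ∀ z ∈ W, σ * (star z ⬝ᵥ z).re ≤ (star z ⬝ᵥ A *ᵥ z).re)
    (hWK : ∀ x ∈ K, ∃ z ∈ W, ∃ c : ℂ, x = z + c • u)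
    {w : ι → ℂ} (hwK : w ∈ K) {N ρ r2 : ℝ} (hN : 0 < N) (hwN : (star w ⬝ᵥ w).re = N)
    (hρ : (star w ⬝ᵥ A *ᵥ w).re = ρ * N) (hr2 : (star (A *ᵥ w) ⬝ᵥ A *ᵥ w).re ≤ (r2 + ρ ^ 2) * N)
    (hρσ : ρ < σ) :
    ρ - r2 / (σ - ρ) ≤ A.minEnergyOn K ∧ A.minEnergyOn K ≤ ρ ∧
      ∃ ψ ∈ K, star ψ ⬝ᵥ ψ = 1 ∧ A *ᵥ ψ = ((A.minEnergyOn K : ℝ) : ℂ) • ψ ∧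
        (∀ φ ∈ K, A *ᵥ φ = ((A.minEnergyOn K : ℝ) : ℂ) • φ → φ = (star ψ ⬝ᵥ φ) • ψ) ∧
        (∀ z ∈ K, star ψ ⬝ᵥ z = 0 → σ * (star z ⬝ᵥ z).re ≤ (star z ⬝ᵥ A *ᵥ z).re) ∧
        (N - ‖star ψ ⬝ᵥ w‖ ^ 2) * (σ - ρ) ^ 2 ≤ r2 * N := by
  have hw0 : w ≠ 0 := by
    rintro rfl
    rw [dotProduct_zero, Complex.zero_re] at hwN
    exact hN.ne' hwN.symm
  obtain ⟨c, hc, hcc, hc1⟩ := exists_normalize hw0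
  rw [hwN] at hcc
  set w' : ι → ℂ := (c : ℂ) • w with hw'
  have hw'K : w' ∈ K := K.smul_mem _ hwK
  have hρ' : (star w' ⬝ᵥ A *ᵥ w').re = ρ := by
    rw [hw', mulVec_smul, star_real_smul_dotProduct_real_smul, Complex.re_ofReal_mul, hρ,
      ← mul_assoc, mul_comm (c * c), mul_assoc, hcc, mul_one]
  have hr2' : (star (A *ᵥ w') ⬝ᵥ A *ᵥ w').re ≤ r2 + ρ ^ 2 := by
    rw [hw', mulVec_smul, star_real_smul_dotProduct_real_smul, Complex.re_ofReal_mul]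
    calc c * c * (star (A *ᵥ w) ⬝ᵥ A *ᵥ w).re ≤ c * c * ((r2 + ρ ^ 2) * N) :=
          mul_le_mul_of_nonneg_left hr2 (mul_self_nonneg c)
      _ = r2 + ρ ^ 2 := by rw [← mul_assoc, mul_comm (c * c), mul_assoc, hcc, mul_one]
  obtain ⟨h1, h2, ψ, hψK, hψ1, hAψ, huniq, hgap, hsin⟩ :=
    sector_enclosure hA K hKA hW hWK hw'K hc1 hρ' hr2' hρσ
  refine ⟨h1, h2, ψ, hψK, hψ1, hAψ, huniq, hgap, ?_⟩
  have hov : ‖star ψ ⬝ᵥ w'‖ ^ 2 = c * c * ‖star ψ ⬝ᵥ w‖ ^ 2 := by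
    rw [hw', dotProduct_smul, smul_eq_mul, norm_mul, Complex.norm_real, Real.norm_of_nonneg hc.le,
      mul_pow, sq c]
  rw [hov] at hsin
  -- multiply by `N`: `c² N = 1`
  have key : (N - ‖star ψ ⬝ᵥ w‖ ^ 2) * (σ - ρ) ^ 2 =
      N * ((1 - c * c * ‖star ψ ⬝ᵥ w‖ ^ 2) * (σ - ρ) ^ 2) := by
    have : N * (c * c) = 1 := by rw [mul_comm]; exact hcc
    calc (N - ‖star ψ ⬝ᵥ w‖ ^ 2) * (σ - ρ) ^ 2
        = (N * 1 - N * (c * c) * ‖star ψ ⬝ᵥ w‖ ^ 2) * (σ - ρ) ^ 2 := by rw [this, mul_one, one_mul]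
      _ = N * ((1 - c * c * ‖star ψ ⬝ᵥ w‖ ^ 2) * (σ - ρ) ^ 2) := by ring
  rw [key, mul_comm r2 N]
  exact mul_le_mul_of_nonneg_left hsin hN.le

/-- **Whole-space form.** For a Hermitian `A` on a nonempty index type with a gap certificate
`(W, u)` for the whole space and a unit trial vector `w` (`Re ⟨w, A w⟩ = ρ < σ`,
`‖A w‖² ≤ r² + ρ²`): `ρ - r²/(σ - ρ) ≤ groundEnergy A ≤ ρ`, the ground state is UNIQUE
(`HasUniqueGroundState`), there is a unit ground-state vector `ψ` with
`(1 - |⟨ψ, w⟩|²)(σ - ρ)² ≤ r²`, and the tracial ground state `groundStateFunctional A` is the vector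
state `O ↦ ⟨ψ, O ψ⟩`; consequently, for a Hermitian `O` with `|⟨x, (O - m) x⟩| ≤ h ‖x‖²` and
`r² ≤ β² (σ - ρ)²`, `|Re ω₀(O) - Re ⟨w, O w⟩| ≤ 2 h (β + β²)`. Saad (1992) Ch. III Thms 3.8–3.9;
Tasaki (2020) §2.1. [cite: Saad1992, Ch. III §3.2 Thm 3.8–3.9] -/
theorem groundState_enclosure [Nonempty ι] {A : Matrix ι ι ℂ} (hA : A.IsHermitian)
    {W : Submodule ℂ (ι → ℂ)} {u : ι → ℂ} {σ : ℝ}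
    (hW : ∀ z ∈ W, σ * (star z ⬝ᵥ z).re ≤ (star z ⬝ᵥ A *ᵥ z).re)
    (hWK : ∀ x : ι → ℂ, ∃ z ∈ W, ∃ c : ℂ, x = z + c • u)
    {w : ι → ℂ} (hw1 : star w ⬝ᵥ w = 1) {ρ r2 : ℝ}
    (hρ : (star w ⬝ᵥ A *ᵥ w).re = ρ) (hr2 : (star (A *ᵥ w) ⬝ᵥ A *ᵥ w).re ≤ r2 + ρ ^ 2)
    (hρσ : ρ < σ) :
    ρ - r2 / (σ - ρ) ≤ A.groundEnergy ∧ A.groundEnergy ≤ ρ ∧ A.HasUniqueGroundState ∧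
      ∃ ψ : ι → ℂ, star ψ ⬝ᵥ ψ = 1 ∧ A *ᵥ ψ = ((A.groundEnergy : ℝ) : ℂ) • ψ ∧
        (1 - ‖star ψ ⬝ᵥ w‖ ^ 2) * (σ - ρ) ^ 2 ≤ r2 ∧
        (∀ O : Matrix ι ι ℂ, A.groundStateFunctional O = star ψ ⬝ᵥ O *ᵥ ψ) ∧
        ∀ {O : Matrix ι ι ℂ} {m h β : ℝ},
          (∀ x : ι → ℂ, ‖star x ⬝ᵥ O *ᵥ x - (m : ℂ) * (star x ⬝ᵥ x)‖ ≤ h * (star x ⬝ᵥ x).re) →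
          0 ≤ β → r2 ≤ β ^ 2 * (σ - ρ) ^ 2 →
          |(A.groundStateFunctional O).re - (star w ⬝ᵥ O *ᵥ w).re| ≤ 2 * h * (β + β ^ 2) := by
  have htop : A.minEnergyOn ⊤ = A.groundEnergy := Matrix.minEnergyOn_top_holds hA
  obtain ⟨h1, h2, ψ, -, hψ1, hAψ, huniq, -, hsin⟩ :=
    sector_enclosure hA ⊤ (fun v _ => Submodule.mem_top) hW (fun x _ => hWK x)
      Submodule.mem_top hw1 hρ hr2 hρσ
  obtain ⟨hfin, hstate⟩ := projState_sectorGroundProj_eq ⊤ Submodule.mem_top hψ1 hAψ huniq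
  have hGS : A.sectorGroundSpace ⊤ = A.groundSpace := by
    rw [Matrix.sectorGroundSpace, htop, top_inf_eq]
    rfl
  have hproj : A.sectorGroundProj ⊤ = A.groundProj := by
    rw [Matrix.sectorGroundProj, Matrix.groundProj_eq, hGS]
  rw [htop] at h1 h2 hAψ
  have hfun : ∀ O : Matrix ι ι ℂ, A.groundStateFunctional O = star ψ ⬝ᵥ O *ᵥ ψ := fun O => by
    rw [Matrix.groundStateFunctional_eq_projState, ← hproj]; exact hstate O
  refine ⟨h1, h2, ?_, ψ, hψ1, hAψ, hsin, hfun, ?_⟩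
  · rw [Matrix.HasUniqueGroundState, Matrix.groundStateDegeneracy, ← hGS]; exact hfin
  · intro O m h β hOform hβ hβr
    rw [hfun O]
    have hσρ : 0 < (σ - ρ) ^ 2 := by have := sub_pos.2 hρσ; positivity
    have hover : 1 - ‖star w ⬝ᵥ ψ‖ ^ 2 ≤ β ^ 2 := by
      have hsym : ‖star w ⬝ᵥ ψ‖ = ‖star ψ ⬝ᵥ w‖ := by
        rw [star_dotProduct, norm_star]
      rw [hsym]
      exact le_of_mul_le_mul_right (hsin.trans hβr) hσρ
    exact abs_expect_sub_expect_le hOform hψ1 hw1 hβ hover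

/-- **Diagonal observables** satisfy the form hypothesis with `m` the midpoint and `h` the half-width
of the range of the (real) diagonal entries: if `|O_ii - m| ≤ h` for all `i` then
`|⟨x, O x⟩ - m ‖x‖²| ≤ h ‖x‖²`. (Double occupancy, `S^z S^z` correlators and `S_zz(q)` are diagonal
in the occupation / `S^z` basis.) [folklore] -/
theorem diagonal_form_bound {f : ι → ℝ} {m h : ℝ} (hf : ∀ i, |f i - m| ≤ h) (x : ι → ℂ) :
    ‖star x ⬝ᵥ diagonal (fun i => (f i : ℂ)) *ᵥ x - (m : ℂ) * (star x ⬝ᵥ x)‖ ≤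
      h * (star x ⬝ᵥ x).re := by
  have hss : ∀ a : ℂ, star a * a = ((‖a‖ ^ 2 : ℝ) : ℂ) := fun a => by
    rw [Complex.star_def, ← Complex.normSq_eq_conj_mul_self, Complex.normSq_eq_norm_sq]
  have hsum : star x ⬝ᵥ diagonal (fun i => (f i : ℂ)) *ᵥ x - (m : ℂ) * (star x ⬝ᵥ x) =
      ∑ i, (((f i - m) * ‖x i‖ ^ 2 : ℝ) : ℂ) := by
    simp only [dotProduct, mulVec_diagonal, Pi.star_apply, Finset.mul_sum, ← Finset.sum_sub_distrib]
    refine Finset.sum_congr rfl fun i _ => ?_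
    rw [mul_left_comm, hss]
    push_cast
    ring
  rw [hsum, ← Complex.ofReal_sum, Complex.norm_real, re_star_dotProduct_self, Finset.mul_sum]
  refine (norm_sum_le _ _).trans (Finset.sum_le_sum fun i _ => ?_)
  rw [Real.norm_eq_abs, abs_mul, abs_of_nonneg (sq_nonneg ‖x i‖)]
  exact mul_le_mul_of_nonneg_right (hf i) (sq_nonneg _)

end TempleKato

end Literature.MathematicalPhysics.QuantumLattice

end
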